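import Summits.CriticalPhenomena.PercolationContinuityZ3.Theorems.Transplant.FKThreeApexTriangle
import HarnessLib

/-!
# Connectivity correlation inequalities for `φ_{w,q}` — the three-apex family: the TRANSFER FORMULA for `K_{1,1,1,n}` (triangle edges included)

Support file (`--supports stmt-CriticalPhenomena-4575`), FK sub-lane `prim-bschramm-fk-3` (gen 13); builds on p205010 (kernel theorem, internal audit
signed; external expert review pending).  No named facts, no sorries; standard axioms.  Layer 2c-ii of the `K_{1,1,1,n}` programme (memo
`bschramm/prim-bschramm-fk-3/THREE-APEX.md` §6): the transfer formula of `…ThreeApexWord` (`K_{3,n}`: weights on the apex–leaf pairs only) extended to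
weight vectors supported on the apex–leaf pairs AND the three apex–apex pairs `ab, ac, bc` — the weighted `K_{1,1,1,n} = K₃ + E_n`, which contains
every graph with a vertex cover of size `≤ 3` as a weight-zero pattern.  **`rcPartitionFunctionW_eq_transfer3T`**:
`Z_w = val_q(T_w · M(z_{n-1}) ⋯ M(z_0) δ_0)` with `T_w = edgeAB(w_{ab}) · edgeAC(w_{ac}) · edgeBC(w_{bc})` (`…ThreeApexTriangle`).  PROOF by rigid
interpolation (`FK.eq_of_affine_of_rigid`): affinity in every apex–leaf pair (`zvec_pin_one` + `affC_conv_leafᵢ`) and in every triangle pair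
(`affC_edgeXY_mul`); at a rigid `w` the triangle letters act on `δ_0` as the basis vector of `triState` (`triLetter_rigid`), the rigid leaf letters
then give `q^{#unattached}·e_{π_n}` (`zvecB_eq`, `…ThreeApexRigid`), and the cluster count of the rigid configuration `triConf ∪ stars` is
`n + blocks(π_n) − #attached` by `conf_inv` (`…ThreeApexClusterCount`) started from the triangle configuration (`clusterCount_triConf`,
`reach_triConf_*`). [cite: Grimmett2006, §1.4 eq. (1.20) (p. 15)] [folklore]
-/

noncomputable section

namespace Summit.CriticalPhenomena.PercolationContinuityZ3.Theorems

namespace FK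

namespace ThreeApex

open Literature.Probability.LatticeModels Literature.Probability.Percolation
open scoped Classical

variable {V : Type*} [Fintype V]

/-! ### The setting -/

section Setting

variable {a b c : V} {v : ℕ → V} {n : ℕ}
variable (hab : a ≠ b) (hac : a ≠ c) (hbc : b ≠ c) (hinj : ∀ j k, j < n → k < n → v j = v k → j = k)
  (hva : ∀ j, j < n → v j ≠ a) (hvb : ∀ j, j < n → v j ≠ b) (hvc : ∀ j, j < n → v j ≠ c)
include hab hac hbc hinj hva hvb hvc

omit [Fintype V] hab hac hbc hinj in
/-- A pair at a leaf is not a triangle pair. [folklore] -/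
theorem apexPair_ne_tri (x : V) {j : ℕ} (hj : j < n) :
    s(x, v j) ≠ s(a, b) ∧ s(x, v j) ≠ s(a, c) ∧ s(x, v j) ≠ s(b, c) := by
  refine ⟨fun h => ?_, fun h => ?_, fun h => ?_⟩
  · rcases Sym2.eq_iff.1 h with ⟨_, h2⟩ | ⟨h1, h2⟩
    · exact hvb j hj h2
    · exact hva j hj h2
  · rcases Sym2.eq_iff.1 h with ⟨_, h2⟩ | ⟨h1, h2⟩
    · exact hvc j hj h2
    · exact hva j hj h2
  · rcases Sym2.eq_iff.1 h with ⟨_, h2⟩ | ⟨h1, h2⟩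
    · exact hvc j hj h2
    · exact hvb j hj h2

omit [Fintype V] hinj hva hvb hvc in
/-- The three triangle pairs differ. [folklore] -/
theorem triPairs_ne : s(a, b) ≠ s(a, c) ∧ s(a, b) ≠ s(b, c) ∧ s(a, c) ≠ s(b, c) := by
  refine ⟨fun h => ?_, fun h => ?_, fun h => ?_⟩
  · rcases Sym2.eq_iff.1 h with ⟨_, h2⟩ | ⟨h1, _⟩
    · exact hbc h2
    · exact hac h1
  · rcases Sym2.eq_iff.1 h with ⟨h1, _⟩ | ⟨h1, _⟩
    · exact hab h1
    · exact hac h1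
  · rcases Sym2.eq_iff.1 h with ⟨h1, _⟩ | ⟨h1, _⟩
    · exact hab h1
    · exact hac h1

omit [Fintype V] hab hac hbc hinj in
/-- Updating a triangle pair does not change the leaf letters. [folklore] -/
theorem leafOf_update_tri (q : ℝ) (w : Sym2 V → unitInterval) {e : Sym2 V} (he : e ∈ triPairs a b c) {j : ℕ} (hj : j < n)
    (t : unitInterval) : leafOf q (Function.update w e t) a b c (v j) = leafOf q w a b c (v j) := by
  obtain ⟨na1, na2, na3⟩ := apexPair_ne_tri hva hvb hvc a hj
  obtain ⟨nb1, nb2, nb3⟩ := apexPair_ne_tri hva hvb hvc b hj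
  obtain ⟨nc1, nc2, nc3⟩ := apexPair_ne_tri hva hvb hvc c hj
  rcases (mem_triPairs_iff a b c e).1 he with rfl | rfl | rfl
  · simp only [leafOf, Function.update_of_ne na1, Function.update_of_ne nb1, Function.update_of_ne nc1]
  · simp only [leafOf, Function.update_of_ne na2, Function.update_of_ne nb2, Function.update_of_ne nc2]
  · simp only [leafOf, Function.update_of_ne na3, Function.update_of_ne nb3, Function.update_of_ne nc3]

omit [Fintype V] hab hac hbc hinj in
/-- … hence not the leaf product. [folklore] -/
theorem zvec_update_tri (q : ℝ) (w : Sym2 V → unitInterval) {e : Sym2 V} (he : e ∈ triPairs a b c) (t : unitInterval) :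
    zvec q (Function.update w e t) a b c v n = zvec q w a b c v n := by
  rw [zvec_eq_prod, zvec_eq_prod]
  refine Finset.prod_congr rfl fun j hj => ?_
  exact leafOf_update_tri hva hvb hvc q w he (Finset.mem_range.1 hj) t

omit [Fintype V] hab hac hbc hinj in
/-- Updating a pair at a leaf does not change the triangle letters. [folklore] -/
theorem triLetter_update_apexPair (w : Sym2 V → unitInterval) (x : V) {j : ℕ} (hj : j < n)
    (t : unitInterval) : triLetter (Function.update w s(x, v j) t) a b c = triLetter w a b c := by
  obtain ⟨n1, n2, n3⟩ := apexPair_ne_tri hva hvb hvc x hj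
  simp only [triLetter, Function.update_of_ne n1.symm, Function.update_of_ne n2.symm, Function.update_of_ne n3.symm]

omit [Fintype V] hab hac hbc in
/-- **Pulling one marked leaf to the front**: after re-pinning the pair `s(x, v j₀)` the leaf product is (the letter of `v j₀`) · (the product of
the other leaf letters, unchanged). [folklore] -/
theorem zvec_pin_one (q : ℝ) (w : Sym2 V → unitInterval) (x : V) {j₀ : ℕ} (hj₀ : j₀ < n) (t : unitInterval) :
    zvec q (Function.update w s(x, v j₀) t) a b c v n =
      leafOf q (Function.update w s(x, v j₀) t) a b c (v j₀) * ∏ j ∈ (Finset.range n).erase j₀, leafOf q w a b c (v j) := by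
  rw [zvec_eq_prod, ← Finset.mul_prod_erase _ _ (Finset.mem_range.2 hj₀)]
  congr 1
  refine Finset.prod_congr rfl fun j hj => ?_
  have hj' : j ≠ j₀ ∧ j < n := by simpa [Finset.mem_erase, Finset.mem_range] using hj
  exact leafOf_update_of_ne hinj hva hvb hvc q w x hj₀ hj'.2 hj'.1 t

omit [Fintype V] in
/-- **Affinity of the `K_{1,1,1,n}` transfer expression in an apex–leaf pair.** [folklore] -/
theorem transfer3T_update_apexPair_affine (q : ℝ) (w : Sym2 V → unitInterval) {x : V} (hx : x = a ∨ x = b ∨ x = c) {j₀ : ℕ}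
    (hj₀ : j₀ < n) (t : unitInterval) :
    transfer3T q (Function.update w s(x, v j₀) t) a b c v n =
      (1 - (t : ℝ)) * transfer3T q (Function.update w s(x, v j₀) 0) a b c v n +
        (t : ℝ) * transfer3T q (Function.update w s(x, v j₀) 1) a b c v n := by
  obtain ⟨nab, nac, nbc⟩ := pairs_at_leaf_ne hab hac hbc hva hvb hj₀
  unfold transfer3T
  rw [triLetter_update_apexPair hva hvb hvc w x hj₀ t, triLetter_update_apexPair hva hvb hvc w x hj₀ 0,
    triLetter_update_apexPair hva hvb hvc w x hj₀ 1, zvec_pin_one hinj hva hvb hvc q w x hj₀ t,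
    zvec_pin_one hinj hva hvb hvc q w x hj₀ 0, zvec_pin_one hinj hva hvb hvc q w x hj₀ 1]
  generalize ∏ j ∈ (Finset.range n).erase j₀, leafOf q w a b c (v j) = R
  have key : AffC (t : ℝ) (leafOf q (Function.update w s(x, v j₀) t) a b c (v j₀) * R)
      (leafOf q (Function.update w s(x, v j₀) 0) a b c (v j₀) * R) (leafOf q (Function.update w s(x, v j₀) 1) a b c (v j₀) * R) := by
    rcases hx with rfl | rfl | rfl
    · simp only [leafOf, Function.update_self, Function.update_of_ne nab.symm, Function.update_of_ne nac.symm, mul_def,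
        Set.Icc.coe_zero, Set.Icc.coe_one]
      exact affC_conv_leaf₁ q _ _ _ _
    · simp only [leafOf, Function.update_self, Function.update_of_ne nab, Function.update_of_ne nbc.symm, mul_def,
        Set.Icc.coe_zero, Set.Icc.coe_one]
      exact affC_conv_leaf₂ q _ _ _ _
    · simp only [leafOf, Function.update_self, Function.update_of_ne nac, Function.update_of_ne nbc, mul_def,
        Set.Icc.coe_zero, Set.Icc.coe_one]
      exact affC_conv_leaf₃ q _ _ _ _
  exact (key.conv_right (triLetter w a b c)).val_eq q

omit [Fintype V] hinj in
/-- **Affinity of the `K_{1,1,1,n}` transfer expression in a triangle pair.** [folklore] -/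
theorem transfer3T_update_tri_affine (q : ℝ) (w : Sym2 V → unitInterval) {e : Sym2 V} (he : e ∈ triPairs a b c) (t : unitInterval) :
    transfer3T q (Function.update w e t) a b c v n =
      (1 - (t : ℝ)) * transfer3T q (Function.update w e 0) a b c v n + (t : ℝ) * transfer3T q (Function.update w e 1) a b c v n := by
  obtain ⟨n12, n13, n23⟩ := triPairs_ne hab hac hbc
  unfold transfer3T
  rw [zvec_update_tri hva hvb hvc q w he t, zvec_update_tri hva hvb hvc q w he 0, zvec_update_tri hva hvb hvc q w he 1]
  generalize zvec q w a b c v n = R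
  have key : AffC (t : ℝ) (triLetter (Function.update w e t) a b c * R) (triLetter (Function.update w e 0) a b c * R)
      (triLetter (Function.update w e 1) a b c * R) := by
    rcases (mem_triPairs_iff a b c e).1 he with rfl | rfl | rfl
    · simp only [triLetter, Function.update_self, Function.update_of_ne n12.symm, Function.update_of_ne n13.symm,
        Set.Icc.coe_zero, Set.Icc.coe_one, mul_assoc]
      exact affC_edgeAB_mul _ _
    · simp only [triLetter, Function.update_self, Function.update_of_ne n12, Function.update_of_ne n23.symm,
        Set.Icc.coe_zero, Set.Icc.coe_one]
      have e' : ∀ s : ℝ, edgeAB ((w s(a, b) : unitInterval) : ℝ) * (edgeAC s * edgeBC ((w s(b, c) : unitInterval) : ℝ)) * R =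
          edgeAC s * (edgeAB ((w s(a, b) : unitInterval) : ℝ) * edgeBC ((w s(b, c) : unitInterval) : ℝ) * R) := fun s => by
        ac_rfl
      rw [e', e', e']
      exact affC_edgeAC_mul _ _
    · simp only [triLetter, Function.update_self, Function.update_of_ne n13, Function.update_of_ne n23,
        Set.Icc.coe_zero, Set.Icc.coe_one]
      have e' : ∀ s : ℝ, edgeAB ((w s(a, b) : unitInterval) : ℝ) * (edgeAC ((w s(a, c) : unitInterval) : ℝ) * edgeBC s) * R =
          edgeBC s * (edgeAB ((w s(a, b) : unitInterval) : ℝ) * edgeAC ((w s(a, c) : unitInterval) : ℝ) * R) := fun s => by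
        ac_rfl
      rw [e', e', e']
      exact affC_edgeBC_mul _ _
  exact key.val_eq q

omit [Fintype V] in
/-- **Affinity on all pairs of `K_{1,1,1,n}`** in the form required by `FK.eq_of_affine_of_rigid`. [folklore] -/
theorem transfer3T_affine (q : ℝ) (w : Sym2 V → unitInterval) {e : Sym2 V} (he : e ∈ fullPairs a b c v n) :
    transfer3T q w a b c v n = (1 - ((w e : unitInterval) : ℝ)) * transfer3T q (Function.update w e 0) a b c v n +
      ((w e : unitInterval) : ℝ) * transfer3T q (Function.update w e 1) a b c v n := by
  rcases (mem_fullPairs_iff a b c v n e).1 he with he | he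
  · obtain ⟨j₀, hj₀, hx⟩ := (mem_apexPairs_iff e).1 he
    have main : ∀ x : V, (x = a ∨ x = b ∨ x = c) → e = s(x, v j₀) →
        transfer3T q w a b c v n = (1 - ((w e : unitInterval) : ℝ)) * transfer3T q (Function.update w e 0) a b c v n +
          ((w e : unitInterval) : ℝ) * transfer3T q (Function.update w e 1) a b c v n := by
      rintro x hx' rfl
      have h := transfer3T_update_apexPair_affine hab hac hbc hinj hva hvb hvc q w hx' hj₀ (w s(x, v j₀))
      rwa [Function.update_eq_self] at h
    rcases hx with h | h | h
    · exact main a (Or.inl rfl) h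
    · exact main b (Or.inr (Or.inl rfl)) h
    · exact main c (Or.inr (Or.inr rfl)) h
  · have h := transfer3T_update_tri_affine hab hac hbc hva hvb hvc (v := v) (n := n) q w he (w e)
    rwa [Function.update_eq_self] at h

/-! ### The rigid case -/

/-- **The `K_{1,1,1,n}` transfer formula at a rigid weight vector.** [cite: Grimmett2006, §1.4 eq. (1.20) (p. 15)] -/
theorem rcPartitionFunctionW_eq_transfer3T_rigid (hcard : Fintype.card V = n + 3) (q : ℝ) (w : Sym2 V → unitInterval)
    (hsupp : ∀ e, e ∉ fullPairs a b c v n → w e = 0)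
    (hrig : ∀ e ∈ fullPairs a b c v n, ((w e : unitInterval) : ℝ) = 0 ∨ ((w e : unitInterval) : ℝ) = 1) :
    rcPartitionFunctionW w q ∅ = transfer3T q w a b c v n := by
  have hR : ∀ e : Sym2 V, ((w e : unitInterval) : ℝ) = 0 ∨ ((w e : unitInterval) : ℝ) = 1 := by
    intro e
    by_cases he : e ∈ fullPairs a b c v n
    · exact hrig e he
    · left; rw [hsupp e he]; rfl
  -- Boolean data
  set att : ℕ → Bool × Bool × Bool := fun j =>
    (decide (((w s(a, v j) : unitInterval) : ℝ) = 1), decide (((w s(b, v j) : unitInterval) : ℝ) = 1),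
      decide (((w s(c, v j) : unitInterval) : ℝ) = 1)) with hatt
  set x : Bool := decide (((w s(a, b) : unitInterval) : ℝ) = 1) with hx
  set y : Bool := decide (((w s(a, c) : unitInterval) : ℝ) = 1) with hy
  set z : Bool := decide (((w s(b, c) : unitInterval) : ℝ) = 1) with hz
  have hbR : ∀ e : Sym2 V, ((w e : unitInterval) : ℝ) = bR (decide (((w e : unitInterval) : ℝ) = 1)) := by
    intro e
    rcases hR e with h | h
    · rw [h]; simp [bR]
    · rw [h]; simp [bR]
  -- right-hand side
  have hzv : zvec q w a b c v n = ∏ j ∈ Finset.range n, leafB q (att j).1 (att j).2.1 (att j).2.2 := by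
    rw [zvec_eq_prod]
    refine Finset.prod_congr rfl fun j _ => ?_
    unfold leafOf leafB
    congr 1
    · exact hbR _
    · exact hbR _
    · exact hbR _
  have htri : triLetter w a b c = basisVec (triState x y z) := by
    unfold triLetter
    rw [hbR s(a, b), hbR s(a, c), hbR s(b, c)]
    exact triLetter_rigid x y z
  have hrhs : transfer3T q w a b c v n = q ^ ((apexState att (triState x y z) n).blocks + (n - attached att n)) := by
    rw [transfer3T, mul_comm, hzv, htri, prod_leafB_mul_basisVec, val_zvecB]
  -- the rigid configuration is `conf n` started from the triangle configuration
  have hconf : {e : Sym2 V | ((w e : unitInterval) : ℝ) = 1} = ↑(conf a b c v att (triConf a b c x y z) n) := by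
    ext e
    simp only [Set.mem_setOf_eq, Finset.mem_coe, mem_conf_iff, mem_star_iff, exists_mem_attFin, mem_triConf_iff]
    constructor
    · intro h1
      have hne : w e ≠ 0 := by
        intro h0; rw [h0] at h1; norm_num at h1
      have he : e ∈ fullPairs a b c v n := by
        by_contra hc; exact hne (hsupp e hc)
      rcases (mem_fullPairs_iff a b c v n e).1 he with he | he
      · obtain ⟨j, hj, hx'⟩ := (mem_apexPairs_iff e).1 he
        right
        refine ⟨j, hj, ?_⟩
        rcases hx' with rfl | rfl | rfl
        · exact Or.inl ⟨by simp only [hatt, decide_eq_true_eq]; exact h1, rfl⟩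
        · exact Or.inr (Or.inl ⟨by simp only [hatt, decide_eq_true_eq]; exact h1, rfl⟩)
        · exact Or.inr (Or.inr ⟨by simp only [hatt, decide_eq_true_eq]; exact h1, rfl⟩)
      · left
        rcases (mem_triPairs_iff a b c e).1 he with rfl | rfl | rfl
        · exact Or.inl ⟨by simp only [hx, decide_eq_true_eq]; exact h1, rfl⟩
        · exact Or.inr (Or.inl ⟨by simp only [hy, decide_eq_true_eq]; exact h1, rfl⟩)
        · exact Or.inr (Or.inr ⟨by simp only [hz, decide_eq_true_eq]; exact h1, rfl⟩)
    · rintro ((⟨h, rfl⟩ | ⟨h, rfl⟩ | ⟨h, rfl⟩) | ⟨j, _, (⟨h, rfl⟩ | ⟨h, rfl⟩ | ⟨h, rfl⟩)⟩)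
      · simp only [hx, decide_eq_true_eq] at h; exact h
      · simp only [hy, decide_eq_true_eq] at h; exact h
      · simp only [hz, decide_eq_true_eq] at h; exact h
      · simp only [hatt, decide_eq_true_eq] at h; exact h
      · simp only [hatt, decide_eq_true_eq] at h; exact h
      · simp only [hatt, decide_eq_true_eq] at h; exact h
  -- cluster count from the invariant started at the triangle configuration
  have hinv := conf_inv a b c v att (triConf a b c x y z) (triState x y z) n hinj hva hvb hvc (triConf_apex a b c x y z)
    (reach_triConf_ab hab hac hbc x y z) (reach_triConf_ac hab hac hbc x y z) (reach_triConf_bc hab hac hbc x y z) n le_rfl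
  obtain ⟨hk, -, -, -, -⟩ := hinv
  have hk0 := clusterCount_triConf hab hac hbc (V := V) x y z
  rw [hcard] at hk0
  have hatt_le := attached_le att n
  rw [rcPartitionFunctionW_rigid_eq_pow w q hR, hconf, hrhs]
  congr 1
  omega

/-- **TRANSFER FORMULA for `K_{1,1,1,n}`.**  Three distinct apices `a, b, c`, leaves `v 0, …, v (n−1)` (pairwise distinct, not apices) exhausting
`V` (`card V = n + 3`), `w` supported on the apex–leaf pairs and the triangle `ab, ac, bc`:
`Z_w = val_q(edgeAB(w_{ab}) · edgeAC(w_{ac}) · edgeBC(w_{bc}) · M(z_{n-1}) ⋯ M(z_0) δ_0)`. [cite: Grimmett2006, §1.4 eq. (1.20) (p. 15)] -/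
theorem rcPartitionFunctionW_eq_transfer3T (hcard : Fintype.card V = n + 3) (q : ℝ) (w : Sym2 V → unitInterval)
    (hsupp : ∀ e, e ∉ fullPairs a b c v n → w e = 0) :
    rcPartitionFunctionW w q ∅ = transfer3T q w a b c v n :=
  eq_of_affine_of_rigid (fullPairs a b c v n) (fun u => rcPartitionFunctionW u q ∅) (fun u => transfer3T q u a b c v n)
    (fun u _ e _ => rcPartitionFunctionW_affine u q e)
    (fun u _ _ he => transfer3T_affine hab hac hbc hinj hva hvb hvc q u he)
    (fun u hu hr => rcPartitionFunctionW_eq_transfer3T_rigid hab hac hbc hinj hva hvb hvc hcard q u hu hr) w hsupp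

end Setting

end ThreeApex

end FK

end Summit.CriticalPhenomena.PercolationContinuityZ3.Theorems

end
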